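import Literature.Analysis.FluidPDE.ElgindiPolarEnergy
import Literature.Analysis.FluidPDE.ElgindiAngularWeightedBounds
import Mathlib.MeasureTheory.Integral.Prod
import HarnessLib

/-!
# Plane integrability against the singular angular weight `sin(2θ)^{−η}` and uniform profile bounds
([Elgindi2021] §7.3, Proposition 7.7, Step 2: the weight `w²/sin(2θ)^η` on the strip)

Topic `Literature/Analysis/FluidPDE`. Proof file (everything proved, no definitions, no named
facts) on the proof path of the named fact
`Literature.Analysis.FluidPDE.Elgindi.ElgindiGhoulMasmoudi2021_stabilityCore`
(`ElgindiStabilityDecomposition.lean`). T. M. Elgindi, Ann. of Math. 194 (2021) =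
arXiv:1904.04795, §7.3, proof of Proposition 7.7, Step 2 "Radial and (weak) angular weights"
(p. 21 of the held text): "As in Step 1, we multiply (7.1) by `−∂_θθΨ w²/sin(2θ)^η` and
integrate." On the strip `(0,∞) × (0,π/2)` the weight `sin(2θ)^{−η}` (`η = 99/100`) is singular
but integrable at `θ = 0, π/2`; this file supplies the plane (`dR dθ`) integrability and Fubini
tools for integrands `H(R,θ)·sin(2θ)^{−η}` with `H` bounded and radially compactly supported, and
the uniform bound `|cos θ·g(R,θ)| ≤ K sin(2θ)` for the profile class (`g ∈ C¹(ℝ²)` compactly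
supported with `g(R,0) = 0`), which makes the quotients `Ψ/sin 2θ`, `∂_RΨ/sin 2θ` of the sharp Hardy
inequality bounded on the strip:

* `integrableOn_strip_mul_rpow`, `integrableOn_strip_mul_rpow_of_continuous`;
* `integral_strip_eq_integral_Ioi_integral_Ioo'`, `integral_strip_eq_integral_Ioo_integral_Ioi'`
  (Fubini over the strip under `IntegrableOn`);
* `integrableOn_Ioo_continuous_mul_rpow` (slices);
* `exists_forall_fst_gt_eq_zero` (a radial bound of a compact support),
  `exists_forall_abs_cos_mul_le_sin_two_mul` (the uniform profile bound).
-/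

noncomputable section

open MeasureTheory Set Real Filter Function
open _root_.Topology

namespace Literature.Analysis.FluidPDE

namespace Elgindi

/-! ### Plane integrability against `sin(2θ)^{−η}` -/

/-- A plane function `H`, a.e.-strongly measurable on the strip, bounded by `C` there and vanishing
for `R > B`, gives an integrable `H·sin(2θ)^{−η}` on the strip, `0 ≤ η < 1`. [folklore] -/
theorem integrableOn_strip_mul_rpow {η : ℝ} (hη0 : 0 ≤ η) (hη1 : η < 1) {H : ℝ × ℝ → ℝ}
    (hm : AEStronglyMeasurable H (volume.restrict strip)) {C B : ℝ}
    (hC : ∀ p ∈ strip, |H p| ≤ C) (hB : ∀ p ∈ strip, B < p.1 → H p = 0) :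
    IntegrableOn (fun p : ℝ × ℝ => H p * Real.sin (2 * p.2) ^ (-η)) strip := by
  -- the dominating product `(C·𝟙_{(0,B]}(R))·sin(2θ)^{−η}`
  set f : ℝ → ℝ := (Ioc 0 B).indicator fun _ => C with hf
  have hfi : Integrable f volume := by
    simp only [hf]
    exact (integrable_indicator_iff measurableSet_Ioc).2 (integrableOn_const (by simp))
  have hfi' : Integrable f (volume.restrict (Ioi (0 : ℝ))) := hfi.restrict
  have hgi : Integrable (fun θ : ℝ => Real.sin (2 * θ) ^ (-η)) (volume.restrict (Ioo 0 (π / 2))) :=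
    integrableOn_sin_two_mul_rpow (r := -η) (by linarith) (by linarith)
  have hprod := hfi'.mul_prod hgi
  rw [Measure.prod_restrict, ← Measure.volume_eq_prod] at hprod
  have hprod' : IntegrableOn (fun z : ℝ × ℝ => f z.1 * Real.sin (2 * z.2) ^ (-η)) strip := hprod
  have hm' : AEStronglyMeasurable (fun p : ℝ × ℝ => H p * Real.sin (2 * p.2) ^ (-η)) (volume.restrict strip) :=
    hm.mul ((by fun_prop : Measurable fun p : ℝ × ℝ => Real.sin (2 * p.2)).pow_const _).aestronglyMeasurable
  refine Integrable.mono' hprod' hm' ?_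
  rw [ae_restrict_iff' measurableSet_strip]
  refine Filter.Eventually.of_forall fun p hp => ?_
  have hθ : p.2 ∈ Ioo 0 (π / 2) := hp.2
  have hs : 0 < Real.sin (2 * p.2) := Real.sin_pos_of_pos_of_lt_pi (by linarith [hθ.1]) (by linarith [hθ.2])
  have hu : 0 ≤ Real.sin (2 * p.2) ^ (-η) := Real.rpow_nonneg hs.le _
  rw [Real.norm_eq_abs, abs_mul, abs_of_nonneg hu]
  rcases le_or_gt p.1 B with hle | hgt
  · have hR : p.1 ∈ Ioc 0 B := ⟨hp.1, hle⟩
    simp only [hf, indicator_of_mem hR]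
    exact mul_le_mul_of_nonneg_right (hC p hp) hu
  · rw [hB p hp hgt, abs_zero, zero_mul]
    have hR : p.1 ∉ Ioc 0 B := fun h => absurd h.2 (not_le.2 hgt)
    simp only [hf, indicator_of_notMem hR, zero_mul]
    exact le_rfl

/-- A compactly supported plane function vanishes for `R` beyond some `B`. [folklore] -/
theorem exists_forall_fst_gt_eq_zero {G : ℝ × ℝ → ℝ} (hs : HasCompactSupport G) :
    ∃ B : ℝ, ∀ p : ℝ × ℝ, B < p.1 → G p = 0 := by
  obtain ⟨B, hB⟩ := hs.isCompact.exists_bound_of_continuousOn (f := fun p : ℝ × ℝ => p.1) continuous_fst.continuousOn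
  refine ⟨B, fun p hp => image_eq_zero_of_notMem_tsupport fun h => ?_⟩
  have := hB p h
  rw [Real.norm_eq_abs] at this
  linarith [le_abs_self p.1]

/-- A continuous compactly supported plane function `G` gives an integrable `G·sin(2θ)^{−η}` on the
strip, `0 ≤ η < 1`. [folklore] -/
theorem integrableOn_strip_mul_rpow_of_continuous {η : ℝ} (hη0 : 0 ≤ η) (hη1 : η < 1)
    {G : ℝ × ℝ → ℝ} (hG : Continuous G) (hs : HasCompactSupport G) :
    IntegrableOn (fun p : ℝ × ℝ => G p * Real.sin (2 * p.2) ^ (-η)) strip := by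
  obtain ⟨C, hC⟩ := hG.norm.bddAbove_range_of_hasCompactSupport hs.norm
  obtain ⟨B, hB⟩ := exists_forall_fst_gt_eq_zero hs
  refine integrableOn_strip_mul_rpow hη0 hη1 hG.aestronglyMeasurable (C := C) (fun p _ => ?_) fun p _ hp => hB p hp
  have h : ‖G p‖ ≤ C := hC ⟨p, rfl⟩
  rwa [Real.norm_eq_abs] at h

/-! ### Fubini over the strip under `IntegrableOn` -/

/-- `∫∫_strip G = ∫_{R>0}∫_{0<θ<π/2} G` for `G` integrable on the strip. [folklore] -/
theorem integral_strip_eq_integral_Ioi_integral_Ioo' {G : ℝ × ℝ → ℝ} (hG : IntegrableOn G strip) :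
    ∫ p in strip, G p = ∫ R in Ioi (0 : ℝ), ∫ θ in Ioo 0 (π / 2), G (R, θ) := by
  have h : IntegrableOn G (Ioi (0 : ℝ) ×ˢ Ioo 0 (π / 2)) ((volume : Measure ℝ).prod volume) := by
    rw [← Measure.volume_eq_prod]; exact hG
  have := setIntegral_prod G h
  rw [← Measure.volume_eq_prod] at this
  exact this

/-- `∫∫_strip G = ∫_{0<θ<π/2}∫_{R>0} G` for `G` integrable on the strip. [folklore] -/
theorem integral_strip_eq_integral_Ioo_integral_Ioi' {G : ℝ × ℝ → ℝ} (hG : IntegrableOn G strip) :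
    ∫ p in strip, G p = ∫ θ in Ioo 0 (π / 2), ∫ R in Ioi (0 : ℝ), G (R, θ) := by
  rw [integral_strip_eq_integral_Ioi_integral_Ioo' hG]
  have h : Integrable (uncurry fun R θ => G (R, θ)) ((volume.restrict (Ioi (0 : ℝ))).prod (volume.restrict (Ioo 0 (π / 2)))) := by
    rw [Measure.prod_restrict, ← Measure.volume_eq_prod]
    exact hG
  exact integral_integral_swap h

/-! ### Slices -/

/-- A continuous `g` gives an integrable `g·sin(2θ)^{−η}` on `(0, π/2)`, `0 ≤ η < 1`. [folklore] -/
theorem integrableOn_Ioo_continuous_mul_rpow {η : ℝ} (hη0 : 0 ≤ η) (hη1 : η < 1) {g : ℝ → ℝ}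
    (hg : Continuous g) :
    IntegrableOn (fun θ => g θ * Real.sin (2 * θ) ^ (-η)) (Ioo 0 (π / 2)) := by
  obtain ⟨M, hM⟩ := isCompact_Icc.exists_bound_of_continuousOn (s := Icc 0 (π / 2)) hg.continuousOn
  refine integrableOn_mul_sin_two_mul_rpow_of_abs_le hη0 hη1 hg.measurable (C := M) fun θ hθ => ?_
  have := hM θ (Ioo_subset_Icc_self hθ)
  rwa [Real.norm_eq_abs] at this

/-! ### The uniform profile bound -/

/-- **`|cos θ·g(R,θ)| ≤ K sin(2θ)` uniformly in `R`** on `[0, π/2]`, for `g ∈ C¹(ℝ²)` compactly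
supported with `g(R,0) = 0` (`|g(R,θ)| ≤ Mθ` with `M = sup|∂_θg|`, and `θ cos θ ≤ (π/4) sin 2θ`):
the quotients `Ψ/sin 2θ`, `∂_RΨ/sin 2θ` of the profile class are bounded on the strip. [folklore] -/
theorem exists_forall_abs_cos_mul_le_sin_two_mul {g : ℝ → ℝ → ℝ} (hg : ContDiff ℝ 1 (uncurry g))
    (hs : HasCompactSupport (uncurry g)) (h0 : ∀ R, g R 0 = 0) :
    ∃ K, 0 ≤ K ∧ ∀ R, ∀ θ ∈ Icc 0 (π / 2), |Real.cos θ * g R θ| ≤ K * Real.sin (2 * θ) := by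
  have hdc : Continuous (uncurry (dθ g)) := (contDiff_dθ_of_contDiff (n := 0) hg).continuous
  have hds : HasCompactSupport (uncurry (dθ g)) := hasCompactSupport_dθ_of hs
  obtain ⟨M, hM⟩ := hdc.norm.bddAbove_range_of_hasCompactSupport hds.norm
  have hMb : ∀ R θ, ‖dθ g R θ‖ ≤ M := fun R θ => hM ⟨(R, θ), rfl⟩
  have hM0 : 0 ≤ M := (norm_nonneg _).trans (hMb 0 0)
  refine ⟨M * (π / 4), by positivity, fun R θ hθ => ?_⟩
  -- the slice and its Lipschitz bound from `θ = 0`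
  have hsl : ContDiff ℝ 1 fun θ => g R θ := hg.comp (contDiff_const.prodMk contDiff_id)
  have hd : Differentiable ℝ fun θ => g R θ := hsl.differentiable (by simp)
  have hderiv : ∀ θ, deriv (fun θ => g R θ) θ = dθ g R θ := fun θ => rfl
  have hlip : |g R θ| ≤ M * θ := by
    have h := Convex.norm_image_sub_le_of_norm_deriv_le (f := fun θ => g R θ) (fun y _ => hd y)
      (fun y _ => by rw [hderiv]; exact hMb R y) convex_univ (mem_univ 0) (mem_univ θ)
    rw [h0 R, sub_zero, sub_zero, Real.norm_eq_abs, Real.norm_eq_abs, abs_of_nonneg hθ.1] at h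
    exact h
  have hc : 0 ≤ Real.cos θ := Real.cos_nonneg_of_mem_Icc ⟨by linarith [hθ.1, Real.pi_pos], hθ.2⟩
  have hj : 2 / π * θ ≤ Real.sin θ := Real.mul_le_sin hθ.1 hθ.2
  have hθle : θ ≤ π / 2 * Real.sin θ := by
    have := mul_le_mul_of_nonneg_left hj (by positivity : (0 : ℝ) ≤ π / 2)
    calc θ = π / 2 * (2 / π * θ) := by field_simp
      _ ≤ _ := this
  rw [abs_mul, abs_of_nonneg hc, Real.sin_two_mul]
  calc Real.cos θ * |g R θ| ≤ Real.cos θ * (M * θ) := mul_le_mul_of_nonneg_left hlip hc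
    _ ≤ Real.cos θ * (M * (π / 2 * Real.sin θ)) :=
        mul_le_mul_of_nonneg_left (mul_le_mul_of_nonneg_left hθle hM0) hc
    _ = M * (π / 4) * (2 * Real.sin θ * Real.cos θ) := by ring

end Elgindi

end Literature.Analysis.FluidPDE
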